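import Mathlib.MeasureTheory.Measure.Lebesgue.Basic
import Mathlib.MeasureTheory.Group.Prod
import Mathlib.MeasureTheory.Integral.Bochner.Set
import HarnessLib

/-!
# Route `FordMaynardSieveConst01651`, target `SieveConst01651` (stmt-Parity-19185), stub `stub_certValuePos` (R2):
# lines are null in the plane `volume.prod volume`

Def-free helper file (glue for the `certP`/`certN` soundness, see `…CertAssembly`): the cell regions `Q_e` (strict
inequalities) and the half-open grid rectangles differ only on vertical / horizontal lines and anti-diagonals, which
are null for `volume.prod volume` on `ℝ × ℝ`: `prod_fst_eq_null`, `prod_snd_eq_null`, `prod_add_eq_null`, and the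
resulting `setIntegral_congr_off_lines` (two sets that agree off finitely many such lines carry the same integral).

References: folklore.
-/

noncomputable section

open MeasureTheory Set

namespace Summit.Parity.GeneralizedHardyLittlewood.FordMaynardSieveConst01651SieveConst01651

/-- A vertical line is null. [folklore] -/
theorem prod_fst_eq_null (c : ℝ) : ((volume : Measure ℝ).prod volume) {p : ℝ × ℝ | p.1 = c} = 0 := by
  have h : {p : ℝ × ℝ | p.1 = c} = ({c} : Set ℝ) ×ˢ (Set.univ : Set ℝ) := by
    ext p; simp
  rw [h, Measure.prod_prod, Real.volume_singleton, zero_mul]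

/-- A horizontal line is null. [folklore] -/
theorem prod_snd_eq_null (c : ℝ) : ((volume : Measure ℝ).prod volume) {p : ℝ × ℝ | p.2 = c} = 0 := by
  have h : {p : ℝ × ℝ | p.2 = c} = (Set.univ : Set ℝ) ×ˢ ({c} : Set ℝ) := by
    ext p; simp
  rw [h, Measure.prod_prod, Real.volume_singleton, mul_zero]

/-- An anti-diagonal is null. [folklore] -/
theorem prod_add_eq_null (c : ℝ) : ((volume : Measure ℝ).prod volume) {p : ℝ × ℝ | p.1 + p.2 = c} = 0 := by
  have hm : MeasurableSet {p : ℝ × ℝ | p.1 + p.2 = c} :=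
    measurableSet_eq_fun (measurable_fst.add measurable_snd) measurable_const
  rw [Measure.prod_apply hm]
  have hsec : ∀ x : ℝ, volume (Prod.mk x ⁻¹' {p : ℝ × ℝ | p.1 + p.2 = c}) = 0 := by
    intro x
    have : Prod.mk x ⁻¹' {p : ℝ × ℝ | p.1 + p.2 = c} = {c - x} := by
      ext y
      simp only [Set.mem_preimage, Set.mem_setOf_eq, Set.mem_singleton_iff]
      constructor
      · intro h; linarith
      · intro h; linarith
    rw [this, Real.volume_singleton]
  simp only [hsec, lintegral_zero]

/-- **Sets agreeing off finitely many lines carry the same integral.**  If `S` and `T` differ only inside a finite union of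
vertical lines, horizontal lines and anti-diagonals, then `∫_S f = ∫_T f`. [folklore] -/
theorem setIntegral_congr_off_lines {S T : Set (ℝ × ℝ)} (A B C : Finset ℝ)
    (h : ∀ p : ℝ × ℝ, p.1 ∉ A → p.2 ∉ B → p.1 + p.2 ∉ C → (p ∈ S ↔ p ∈ T)) (f : ℝ × ℝ → ℝ) :
    (∫ p in S, f p ∂((volume : Measure ℝ).prod volume)) =
      ∫ p in T, f p ∂((volume : Measure ℝ).prod volume) := by
  refine setIntegral_congr_set ?_
  set N : Set (ℝ × ℝ) := (⋃ a ∈ A, {p : ℝ × ℝ | p.1 = a}) ∪ (⋃ b ∈ B, {p : ℝ × ℝ | p.2 = b}) ∪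
    ⋃ c ∈ C, {p : ℝ × ℝ | p.1 + p.2 = c} with hN
  have hnull : ((volume : Measure ℝ).prod volume) N = 0 := by
    rw [hN]
    refine measure_union_null (measure_union_null ?_ ?_) ?_
    · exact (measure_biUnion_null_iff A.countable_toSet).2 fun a _ => prod_fst_eq_null a
    · exact (measure_biUnion_null_iff B.countable_toSet).2 fun b _ => prod_snd_eq_null b
    · exact (measure_biUnion_null_iff C.countable_toSet).2 fun c _ => prod_add_eq_null c
  have hae : ∀ᵐ p ∂((volume : Measure ℝ).prod volume), p ∉ N := measure_eq_zero_iff_ae_notMem.1 hnull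
  filter_upwards [hae] with p hp
  have hp' : p.1 ∉ A ∧ p.2 ∉ B ∧ p.1 + p.2 ∉ C := by
    simp only [hN, Set.mem_union, Set.mem_iUnion, Set.mem_setOf_eq, not_or, not_exists] at hp
    refine ⟨fun ha => hp.1.1 _ (by exact_mod_cast ha) rfl, fun hb => hp.1.2 _ (by exact_mod_cast hb) rfl,
      fun hc => hp.2 _ (by exact_mod_cast hc) rfl⟩
  exact propext (h p hp'.1 hp'.2.1 hp'.2.2)

end Summit.Parity.GeneralizedHardyLittlewood.FordMaynardSieveConst01651SieveConst01651

end
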